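/-
Copyright: public-domain mathematics; typed transcription for the H21 Literature library (cell lit-balaban,
reader/typer seat r02 gen 5 = literature-prover-lit-balaban-r02-g5-0).

statement-level skeleton of published theorems with citation tags; proofs where landed; nothing here is a claim about the Yang–Mills mass gap

# Bałaban, *Propagators and renormalization transformations for lattice gauge theories. I*,
# Commun. Math. Phys. **95** (1984) 17–40 — the partition of unity (1.118) p. 36 WITH THE PRINTED PROFILE,
# on a torus whose period is a multiple of the cube scale `M₀`

[cite: Balaban1984PropagatorsI]  T. Bałaban, Commun. Math. Phys. 95 (1984) 17–40, p. 36 (PDF p. 20), display (1.118),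
verbatim (OCR layer of the held scan `paper:balaban1984-cmp95-propagators-rt-i` p0020.txt, checked against the
b2b render p020):

  "We consider the lattice of cubes of size M₀, M₀ = L^{m₀}, defined by the lattice T^{(k+m₀)}_{M₀}, and cubes □_z of
  size 2M₀ and with a center at the point z ∈ T^{(k+m₀)}_{M₀}.  These cubes cover the lattice T_η.  We construct a
  partition of unity taking the functions `h_z(x) = Π_{μ=1}^d h((x_μ − z_μ)/M₀)`, `h ∈ C₀^∞(]−⅔, ⅔[)`, `h(t) = 1` for
  `t ∈ [−⅓, ⅓]`, h is chosen in such a way that `Σ_n h²(t − n) = 1`, hence `Σ_z h_z²(x) = 1`.  (1.118)"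

WHAT THIS MODULE ADDS (SKELETON row B5.Eq1.119 [(1.118)–(1.119)], reading note F6 / DIVERGENCES D-b05g5.2 (i)(iii),
D-b05g5.4 (i) of the earlier torus files).  The tree already has two torus partitions for (1.118):
`B5TorusPartition` (normalised Lipschitz bumps, any torus, support radius `2M₀`, first differences only) and
`B5SmoothPartition` (a `C^{1,1}` profile without plateau, bounded second differences).  Neither uses the PRINTED
profile.  Since `B4PartitionUnity22` (r01 gen 5, p251869) the printed profile is in the tree:
`h := B4PartitionUnity22.hprof ∈ C^∞`, `h = 1` on `[−⅓, ⅓]` (`hprof_eq_one_third`), `tsupport h ⊂ ]−⅔, ⅔[`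
(`tsupport_hprof_subset_Ioo`), `Σ_{n∈ℤ} h(t − n)² = 1` EXACTLY (`hasSum_hprof_sq`).  This file builds (1.118) from
THAT profile in the printed geometric setting — the centre lattice `T^{(k+m₀)}_{M₀}` is a sublattice of the torus,
i.e. the cube scale `M₀` DIVIDES the period, `N_i = M₀·P_i` with `P_i ≥ 2` cubes per direction — and proves every
clause of the display:

§1 (the circle).  `crep P u = u − P·round(u/P)` (the centred representative of `u mod P`, `|crep| ≤ P/2`) and the
periodised profile `hper P u := h(crep P u)`.  For `P ≥ 2` the supports of the translates `h(· − nP)` are disjoint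
and: `hper` is `P`-periodic (`hper_add_int_mul`); `hper P u = h u` for `|u| < 1` (`hper_eq_hprof`); LOCAL CHART
`hper_local`: near every point `hper P` coincides with an integer translate `h(· − mP)` on a window of half-width
`3/8`; and **`Σ_{c ∈ ℤ/Pℤ} hper P (u − c)² = 1`** (`sum_hper_sq`, from `B4PartitionUnity22.sum_hprof_sq`: the `P`
residues pick out exactly the integers `n` with `h(u − n) ≠ 0`).

§2 (the torus, real lifted coordinates).  `hzR P M₀ z y := Π_i hper (P i) (y_i/M₀ − z_i)` for centres
`z ∈ Π_i ℤ/P_iℤ` and `y ∈ ℝ^d`: **`Σ_z hzR z y² = 1`** (`sum_hzR_sq`, every `y`, via `Fintype.prod_sum`);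
`N`-periodicity in each coordinate (`hzR_add_period`, `N_i = M₀P_i`); the local chart `hzR_local`
(`hzR z = B4PartitionUnity22.hCube M₀ j` on every window of half-width `⅜M₀`, some `j ∈ ℤ^d`), whence the printed
sizes of the commutator terms (1.121) p. 37 / (1.128) p. 38 for `M₀ ≥ 3` and steps `|η| ≤ 1`:
`|h_z(y + ηe_μ) − h_z(y)| ≤ sup|h′|·|η|/M₀` (`abs_hzR_diff_le`), `|h_z(y + ηe_μ) − 2h_z(y) + h_z(y − ηe_μ)| ≤ sup|h″|·η²/M₀²`
(`abs_hzR_second_diff_le`), `|Δ^η h_z(y)| ≤ d·sup|h″|/M₀²` (`abs_latticeLaplacian_hzR_le`) — uniformly in the torus,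
in `z`, in `y` and in `η`.

§3 (torus sites).  `hz118 N M₀ z x := hzR (N/M₀) M₀ z (val x)` on `B4Sect5Torus.TSite d N` over the centre set
`B5TorusCover.Ctr N M₀` (for `M₀ ∣ N_i` exactly the printed `T^{(k+m₀)}_{M₀}`): **(1.118) `Σ_z h_z(x)² = 1`**
(`sum_hz118_sq`); `0 ≤ h_z ≤ 1`; the size of the argument in torus terms
(`M₀·|crep P ((a : ℤ)/M₀)| = dist(a, Nℤ)`, `natMul_abs_crep_eq_circAbs`); PLATEAU `h_z(x) = 1` for
`dist_∞(x, z) ≤ M₀/3` (`hz118_eq_one`) and SUPPORT `h_z(x) = 0` once `dist_∞(x, z) ≥ ⅔M₀` (`hz118_eq_zero_of_le`) —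
so `supp h_z ⊂ □_z` (the cube of size `2M₀` centred at `z`), as printed; invariance under the lift
(`hz118_eq_hzR_of_lift`).

§4 (multiplication operators = the data of `B5Local114.Realisation`).  With `X := B5TorusCover.UT N`, `S := Ctr N M₀`,
`V := EuclideanSpace ℝ ι` fibred over the torus by `π : ι → UT N` and `Hop118 z := mulOp (h_z ∘ π)`:
**`h118_printed : Σ_z Hop118 z * Hop118 z = 1`** (the field `h118`), `symmH_printed` (field `symmH`),
`norm_Hop118_le` (`‖H_z v‖ ≤ ‖v‖`), `Hop118_eq_zero_of_far` / `Hop118_eq_zero_of_supp` (the support half of `hJloc`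
with support radius `⅔M₀`).  The cover geometry fields `hν`, `hrow`, `hdist` are profile-independent and already
discharged in `B5TorusCover` (`coverMult_le`, `coverRowSum_le`).

§5 (v1.1, same seat).  SMOOTHNESS AS PRINTED: the periodised profile is `C^∞` on `ℝ` (`contDiff_hper`, from the
local charts of §1) and `y ↦ h_z(y)` is `C^∞` on `ℝ^d` (`contDiff_hzR`) — so the torus functions of §2–§3 are restrictions
of `C^∞` functions of the coordinates, exactly as «h ∈ C₀^∞» in (1.118).  (v1.1 = v1 p253054 + §5; no v1 declaration
changed.)  (v1.2 DOCSTRING-ONLY, r02 gen 13, QUOTE-AUDIT-B5 §G G2: three theorem titles carried our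
shorthand "∂h_z = O(M₀⁻¹)" / "Δh_z = O(M₀⁻²)" inside guillemets — now plain; guillemets in this file = verbatim print only;
declarations byte-identical.)

HYPOTHESES, EXPLICIT.  `P_i = N_i/M₀ ≥ 2` (at least two cubes per direction — on a one-cube torus the printed
identity `Σ_n h²(t − n) = 1` does not descend to `ℤ/1ℤ`); `N_i = M₀·P_i` for the support/plateau/periodicity
statements in torus distance (the printed sublattice situation); `M₀ ≥ 3` and `|η| ≤ 1` (lattice units) for the
difference bounds (so that a lattice step stays inside one local chart; print: "M₀ sufficiently large", p. 37).
The profile constants are `D1 hprof = sup|h′|`, `D2 hprof = sup|h″|` of `B4PartitionUnity22` (finite by compact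
support, `exists_deriv_bounds`).

HONEST LABELLING.  Everything here is kernel-proved; the only claims attributed to the paper are the quoted sentence
and display (1.118) and the sizes `O(M₀⁻¹)`, `O(M₀⁻²)` of `∂h_z`, `Δh_z` used on p. 38 ("The operator K(h) is a
simple, short-ranged, first order differential operator … (1.126) gives a bound with a small factor O(M₀⁻¹)").
Imports: `B4PartitionUnity22` (the profile), `B5TorusPartition` (the `mulOp` calculus; hence `B5TorusCover`,
`B4Sect5Torus`), Mathlib.  value = the printed partition of unity of (1.118) as a kernel object on the torus with every
printed property, i.e. the input `h118`/`symmH`/`hJloc` of the L² walk (1.123)–(1.131) in its printed form — NOT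
summit progress.
-/
import Mathlib
import Literature.MathematicalPhysics.QuantumFieldTheory.Balaban1983to89.B4PartitionUnity22
import Literature.MathematicalPhysics.QuantumFieldTheory.Balaban1983to89.B5TorusPartition

open Finset

namespace Literature.MathematicalPhysics.QuantumFieldTheory.Balaban1983to89.B5Partition118Printed

open B4PartitionUnity22 (hprof hprof_nonneg hprof_le_one hprof_eq_one_third hprof_eq_zero hprof_eq_zero_two_thirds
  contDiff_hprof hasCompactSupport_hprof tsupport_hprof_subset_Ioo hasSum_hprof_sq sum_hprof_sq hCube D1 D2
  D1_nonneg D2_nonneg abs_hCube_diff_le abs_hCube_second_diff_le abs_latticeLaplacian_hCube_le)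
open B4TorusKernel.MultiPeriod (circAbs circAbs_nonneg circAbs_le_abs circAbs_add_mul abs_add_mul_centre centre)
open B4Sect5Torus (TSite ccoord tdist circAbs_le_tdist ccoord_cast)
open B5TorusCover (nC one_le_nC Ctr ctr ctr_val UT ctrU)
open B5TorusPartition (mulOp mulOp_apply sum_mulOp_mul_self inner_mulOp_left norm_mulOp_le mulOp_eq_zero_of_vanish)

noncomputable section

/-! ## §0  The printed profile (re-export of `B4PartitionUnity22`, for the row's decl cell) -/

/-- **The profile `h` of (1.118) AS PRINTED**: `h ∈ C^∞`, `tsupport h ⊂ ]−⅔, ⅔[` (so `h ∈ C₀^∞(]−⅔, ⅔[)`),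
`h(t) = 1` for `t ∈ [−⅓, ⅓]`, and `Σ_{n∈ℤ} h²(t − n) = 1` for every real `t` — all four for the concrete
`h = B4PartitionUnity22.hprof`. [cite: Balaban1984PropagatorsI, (1.118) p.36] -/
theorem profile118_printed :
    ContDiff ℝ (⊤ : ℕ∞) hprof ∧ tsupport hprof ⊆ Set.Ioo (-(2 / 3 : ℝ)) (2 / 3) ∧
      (∀ t : ℝ, |t| ≤ 1 / 3 → hprof t = 1) ∧ ∀ t : ℝ, HasSum (fun n : ℤ => hprof (t - n) ^ 2) 1 :=
  ⟨contDiff_hprof, tsupport_hprof_subset_Ioo, fun _ ht => hprof_eq_one_third ht, hasSum_hprof_sq⟩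

/-! ## §1  The circle `ℝ/Pℤ`: centred representative and the periodised profile -/

section Circle

/-- The centred representative of `u` modulo `P`: `crep P u = u − P·round(u/P)`. (plumbing of the printed torus partition) [cite: Balaban1984PropagatorsI, (1.118) p.36] -/
def crep (P : ℝ) (u : ℝ) : ℝ := u - P * round (u / P)

/-- `|crep P u| ≤ P/2`. (plumbing of the printed torus partition) [cite: Balaban1984PropagatorsI, (1.118) p.36] -/
theorem abs_crep_le {P : ℝ} (hP : 0 < P) (u : ℝ) : |crep P u| ≤ P / 2 := by
  unfold crep
  have h := abs_sub_round (u / P)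
  have e : u - P * round (u / P) = P * (u / P - round (u / P)) := by
    rw [mul_sub, mul_div_cancel₀ _ hP.ne']
  rw [e, abs_mul, abs_of_pos hP]
  calc P * |u / P - round (u / P)| ≤ P * (1 / 2) := mul_le_mul_of_nonneg_left h hP.le
    _ = P / 2 := by ring

/-- `crep P u` is a closest point to `0` of `u + Pℤ`: `|crep P u| ≤ |u − mP|` for every integer `m`. (plumbing of the printed torus partition) [cite: Balaban1984PropagatorsI, (1.118) p.36] -/
theorem abs_crep_le_abs_sub {P : ℝ} (hP : 0 < P) (u : ℝ) (m : ℤ) : |crep P u| ≤ |u - m * P| := by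
  unfold crep
  have h := round_le (u / P) m
  have e1 : u - P * round (u / P) = P * (u / P - round (u / P)) := by
    rw [mul_sub, mul_div_cancel₀ _ hP.ne']
  have e2 : u - m * P = P * (u / P - m) := by
    rw [mul_sub, mul_div_cancel₀ _ hP.ne', mul_comm]
  rw [e1, e2, abs_mul, abs_mul, abs_of_pos hP]
  exact mul_le_mul_of_nonneg_left h hP.le

/-- `crep P u ∈ u + Pℤ`: `crep P u = u − (round(u/P))·P`. (plumbing of the printed torus partition) [cite: Balaban1984PropagatorsI, (1.118) p.36] -/
theorem crep_eq_sub (P u : ℝ) : crep P u = u - (round (u / P) : ℝ) * P := by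
  unfold crep; ring

/-- `P`-periodicity: `crep P (u + kP) = crep P u`. (plumbing of the printed torus partition) [cite: Balaban1984PropagatorsI, (1.118) p.36] -/
theorem crep_add_int_mul {P : ℝ} (hP : P ≠ 0) (u : ℝ) (k : ℤ) : crep P (u + k * P) = crep P u := by
  unfold crep
  rw [show (u + k * P) / P = u / P + k by rw [add_div, mul_div_cancel_right₀ _ hP], round_add_intCast]
  push_cast
  ring

/-- On the centred window `|u| < P/2` the representative is `u` itself. (plumbing of the printed torus partition) [cite: Balaban1984PropagatorsI, (1.118) p.36] -/
theorem crep_eq_self {P : ℝ} (hP : 0 < P) {u : ℝ} (hu : |u| < P / 2) : crep P u = u := by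
  unfold crep
  have h : round (u / P) = 0 := by
    rw [round_eq_zero_iff]
    rw [abs_lt] at hu
    constructor
    · rw [le_div_iff₀ hP]; linarith
    · rw [div_lt_iff₀ hP]; linarith
  rw [h, Int.cast_zero, mul_zero, sub_zero]

/-- **The periodised printed profile** on `ℝ/Pℤ`: `hper P u = h(crep P u)` — for `P ≥ 2` this is
`Σ_{n∈ℤ} h(u − nP)` (at most one non-zero term). [cite: Balaban1984PropagatorsI, (1.118) p.36] -/
def hper (P : ℕ) (u : ℝ) : ℝ := hprof (crep P u)

/-- `0 ≤ hper P u`. [cite: Balaban1984PropagatorsI, (1.118) p.36] -/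
theorem hper_nonneg (P : ℕ) (u : ℝ) : 0 ≤ hper P u := hprof_nonneg _

/-- `hper P u ≤ 1`. [cite: Balaban1984PropagatorsI, (1.118) p.36] -/
theorem hper_le_one (P : ℕ) (u : ℝ) : hper P u ≤ 1 := hprof_le_one _

/-- `P`-periodicity of the periodised profile. [cite: Balaban1984PropagatorsI, (1.118) p.36] -/
theorem hper_add_int_mul {P : ℕ} (hP : 1 ≤ P) (u : ℝ) (k : ℤ) : hper P (u + k * P) = hper P u := by
  unfold hper
  rw [crep_add_int_mul (by exact_mod_cast (show P ≠ 0 by omega)) u k]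

/-- On `|u| < 1` (which contains the support window of `h`) and for `P ≥ 2`: `hper P u = h u`.
[cite: Balaban1984PropagatorsI, (1.118) p.36] -/
theorem hper_eq_hprof {P : ℕ} (hP : 2 ≤ P) {u : ℝ} (hu : |u| < 1) : hper P u = hprof u := by
  unfold hper
  have hP' : (2 : ℝ) ≤ P := by exact_mod_cast hP
  rw [crep_eq_self (by linarith) (by linarith)]

/-- PLATEAU: `hper P u = 1` whenever the circular size of `u` is `≤ ⅓`. [cite: Balaban1984PropagatorsI, (1.118) p.36] -/
theorem hper_eq_one {P : ℕ} {u : ℝ} (hu : |crep P u| ≤ 1 / 3) : hper P u = 1 := hprof_eq_one_third hu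

/-- SUPPORT: `hper P u = 0` whenever the circular size of `u` is `≥ ⅔`. [cite: Balaban1984PropagatorsI, (1.118) p.36] -/
theorem hper_eq_zero {P : ℕ} {u : ℝ} (hu : 2 / 3 ≤ |crep P u|) : hper P u = 0 := hprof_eq_zero_two_thirds hu

/-- **LOCAL CHART** (`P ≥ 2`): near every point `u₀` the periodised profile is an integer translate of the printed
profile on the window of half-width `⅜`: `∃ m ∈ ℤ, ∀ v, |v − u₀| ≤ ⅜ → hper P v = h(v − mP)`.  (If `round(v/P) ≠ m`
both sides vanish: each is `h` at a point of size `≥ P/2 − ⅜ ≥ ⅝`.) (plumbing of the printed torus partition) [cite: Balaban1984PropagatorsI, (1.118) p.36] -/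
theorem hper_local {P : ℕ} (hP : 2 ≤ P) (u₀ : ℝ) :
    ∃ m : ℤ, ∀ v : ℝ, |v - u₀| ≤ 3 / 8 → hper P v = hprof (v - m * P) := by
  have hP' : (2 : ℝ) ≤ P := by exact_mod_cast hP
  have hP0 : (0 : ℝ) < P := by linarith
  refine ⟨round (u₀ / P), fun v hv => ?_⟩
  set m := round (u₀ / P) with hm
  set m' := round (v / P) with hm'
  by_cases hmm : m' = m
  · unfold hper
    rw [crep_eq_sub, ← hm', hmm]
  · -- both sides vanish
    have hv' : |crep (P : ℝ) v| ≤ P / 2 := abs_crep_le hP0 v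
    have hu₀ : |u₀ - m * P| ≤ P / 2 := by
      have := abs_crep_le hP0 u₀
      rwa [crep_eq_sub] at this
    have hvm : |v - m * P| ≤ 3 / 8 + P / 2 := by
      calc |v - m * P| = |(v - u₀) + (u₀ - m * P)| := by ring_nf
        _ ≤ |v - u₀| + |u₀ - m * P| := abs_add_le _ _
        _ ≤ 3 / 8 + P / 2 := add_le_add hv hu₀
    have hgap : (P : ℝ) ≤ |(m' : ℝ) * P - m * P| := by
      rw [← sub_mul, abs_mul, abs_of_pos hP0, ← Int.cast_sub]
      have h1 : (1 : ℤ) ≤ |m' - m| := Int.one_le_abs (sub_ne_zero.mpr hmm)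
      have h1' : (1 : ℝ) ≤ |((m' - m : ℤ) : ℝ)| := by rw [← Int.cast_abs]; exact_mod_cast h1
      nlinarith
    have hcrep : crep (P : ℝ) v = v - m' * P := by rw [crep_eq_sub]
    -- (a) the right side vanishes
    have ha : 5 / 8 ≤ |v - m * P| := by
      have : |(m' : ℝ) * P - m * P| ≤ |v - m' * P| + |v - m * P| := by
        calc |(m' : ℝ) * P - m * P| = |(v - m * P) - (v - m' * P)| := by ring_nf
          _ ≤ |v - m * P| + |v - m' * P| := abs_sub _ _
          _ = |v - m' * P| + |v - m * P| := add_comm _ _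
      rw [← hcrep] at this
      linarith
    -- (b) the left side vanishes
    have hb : 5 / 8 ≤ |crep (P : ℝ) v| := by
      have : |(m' : ℝ) * P - m * P| ≤ |v - m' * P| + |v - m * P| := by
        calc |(m' : ℝ) * P - m * P| = |(v - m * P) - (v - m' * P)| := by ring_nf
          _ ≤ |v - m * P| + |v - m' * P| := abs_sub _ _
          _ = |v - m' * P| + |v - m * P| := add_comm _ _
      rw [← hcrep] at this
      linarith
    unfold hper
    rw [hprof_eq_zero hb, hprof_eq_zero ha]

/-- the residue-to-integer map used in `sum_hper_sq`: `c ↦ c + P·round((u − c)/P)`, so that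
`crep P (u − c) = u − (c + P·round((u − c)/P))`. (plumbing of the printed torus partition) [cite: Balaban1984PropagatorsI, (1.118) p.36] -/
def nOf (P : ℕ) (u : ℝ) (c : Fin P) : ℤ := (c.val : ℤ) + (P : ℤ) * round ((u - c.val) / (P : ℝ))

/-- `hper P (u − c) = h(u − nOf c)`. (plumbing of the printed torus partition) [cite: Balaban1984PropagatorsI, (1.118) p.36] -/
theorem hper_sub_eq (P : ℕ) (u : ℝ) (c : Fin P) : hper P (u - c.val) = hprof (u - (nOf P u c : ℝ)) := by
  unfold hper nOf crep
  congr 1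
  push_cast
  ring

/-- `nOf` is injective (distinct residues give distinct integers). (plumbing of the printed torus partition) [cite: Balaban1984PropagatorsI, (1.118) p.36] -/
theorem nOf_injective {P : ℕ} (hP : 1 ≤ P) (u : ℝ) : Function.Injective (nOf P u) := by
  intro c c' h
  unfold nOf at h
  have hP0 : (0 : ℤ) < P := by exact_mod_cast hP
  -- `c − c' = P·(r' − r)` with `|c − c'| < P` forces `r = r'`
  have key : ((c.val : ℤ) - c'.val) =
      (P : ℤ) * (round ((u - c'.val) / (P : ℝ)) - round ((u - c.val) / (P : ℝ))) := by
    linarith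
  have hlt : |((c.val : ℤ) - c'.val)| < P := by
    rw [abs_lt]
    constructor <;> omega
  have hr : round ((u - c'.val) / (P : ℝ)) - round ((u - c.val) / (P : ℝ)) = 0 := by
    by_contra hne
    have h1 : (1 : ℤ) ≤ |round ((u - c'.val) / (P : ℝ)) - round ((u - c.val) / (P : ℝ))| :=
      Int.one_le_abs hne
    have : (P : ℤ) ≤ |((c.val : ℤ) - c'.val)| := by
      rw [key, abs_mul, abs_of_pos hP0]
      nlinarith
    omega
  have hcc : (c.val : ℤ) = c'.val := by
    rw [hr, mul_zero] at key
    linarith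
  exact Fin.ext (by exact_mod_cast hcc)

/-- every integer `n` with `h(u − n) ≠ 0` is `nOf c` for the residue `c = n mod P` (`P ≥ 2`). (plumbing of the printed torus partition) [cite: Balaban1984PropagatorsI, (1.118) p.36] -/
theorem exists_nOf_eq {P : ℕ} (hP : 2 ≤ P) (u : ℝ) {n : ℤ} (hn : hprof (u - n) ≠ 0) :
    ∃ c : Fin P, nOf P u c = n := by
  have hP0 : (0 : ℤ) < P := by exact_mod_cast (show 0 < P by omega)
  have hPr : (0 : ℝ) < P := by exact_mod_cast (show 0 < P by omega)
  -- `|u − n| < 5/8`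
  have hun : |u - n| < 5 / 8 := by
    by_contra hge
    exact hn (hprof_eq_zero (not_lt.mp hge))
  -- the residue
  have hr0 : 0 ≤ n % (P : ℤ) := Int.emod_nonneg _ hP0.ne'
  have hrP : n % (P : ℤ) < P := Int.emod_lt_of_pos _ hP0
  refine ⟨⟨(n % (P : ℤ)).toNat, by omega⟩, ?_⟩
  unfold nOf
  have hval : (((n % (P : ℤ)).toNat : ℕ) : ℤ) = n % (P : ℤ) := Int.toNat_of_nonneg hr0
  simp only [hval]
  have hcast : (((n % (P : ℤ)).toNat : ℕ) : ℝ) = ((n % (P : ℤ) : ℤ) : ℝ) := by exact_mod_cast hval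
  rw [hcast]
  -- `u − n % P = (u − n) + P·(n / P)`
  have hdiv : (P : ℤ) * (n / (P : ℤ)) + n % (P : ℤ) = n := Int.mul_ediv_add_emod n P
  have hq : (u - ((n % (P : ℤ) : ℤ) : ℝ)) / (P : ℝ) = (u - n) / P + ((n / (P : ℤ) : ℤ) : ℝ) := by
    have : ((n % (P : ℤ) : ℤ) : ℝ) = (n : ℝ) - (P : ℝ) * ((n / (P : ℤ) : ℤ) : ℝ) := by
      have h' : (P : ℝ) * ((n / (P : ℤ) : ℤ) : ℝ) + ((n % (P : ℤ) : ℤ) : ℝ) = n := by exact_mod_cast hdiv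
      linarith
    rw [this]
    field_simp
    ring
  have hround : round ((u - n) / (P : ℝ)) = 0 := by
    rw [round_eq_zero_iff]
    have hP2 : (2 : ℝ) ≤ P := by exact_mod_cast hP
    rw [abs_lt] at hun
    constructor
    · rw [le_div_iff₀ hPr]; nlinarith
    · rw [div_lt_iff₀ hPr]; nlinarith
  rw [hq, round_add_intCast, hround, zero_add]
  linarith

/-- **`Σ_{c ∈ ℤ/Pℤ} hper P (u − c)² = 1` for every real `u` and every `P ≥ 2`** — the printed
"`Σ_n h²(t − n) = 1`" descended to the circle of `P` cubes. [cite: Balaban1984PropagatorsI, (1.118) p.36] -/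
theorem sum_hper_sq {P : ℕ} (hP : 2 ≤ P) (u : ℝ) : ∑ c : Fin P, hper P (u - c.val) ^ 2 = 1 := by
  classical
  simp_rw [hper_sub_eq]
  have hinj := nOf_injective (show 1 ≤ P by omega) u
  rw [← Finset.sum_image (f := fun n : ℤ => hprof (u - n) ^ 2)
    (fun c _ c' _ h => hinj h)]
  apply sum_hprof_sq
  intro n hn
  obtain ⟨c, hc⟩ := exists_nOf_eq hP u hn
  exact Finset.mem_image.mpr ⟨c, Finset.mem_univ _, hc⟩

/-- **the circular size of the argument in torus terms**: for integers `a` and `N = M₀·P`,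
`M₀·|crep P (a/M₀)| = dist(a, Nℤ) = circAbs N a`. (plumbing of the printed torus partition) [cite: Balaban1984PropagatorsI, (1.118) p.36] -/
theorem natMul_abs_crep_eq_circAbs {M₀ P : ℕ} (hM : 1 ≤ M₀) (hP : 1 ≤ P) (a : ℤ) :
    (M₀ : ℝ) * |crep (P : ℝ) ((a : ℝ) / M₀)| = (circAbs (M₀ * P) a : ℝ) := by
  have hM0 : (0 : ℝ) < M₀ := by exact_mod_cast hM
  have hP0 : (0 : ℝ) < P := by exact_mod_cast hP
  have hN : 1 ≤ M₀ * P := Nat.one_le_iff_ne_zero.mpr (Nat.mul_ne_zero (by omega) (by omega))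
  -- `M₀·crep P (a/M₀) = a − (round)·N`
  have e1 : (M₀ : ℝ) * crep (P : ℝ) ((a : ℝ) / M₀) = a - (round ((a : ℝ) / M₀ / P) : ℝ) * ((M₀ * P : ℕ) : ℝ) := by
    unfold crep
    push_cast
    rw [mul_sub, mul_div_cancel₀ _ hM0.ne']
    ring
  apply le_antisymm
  · -- `M₀|crep| ≤ |a + N·centre| = circAbs`
    have h1 : |crep (P : ℝ) ((a : ℝ) / M₀)| ≤ |(a : ℝ) / M₀ - (-(centre (M₀ * P) a) : ℤ) * P| :=
      abs_crep_le_abs_sub hP0 _ _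
    have h2 : (M₀ : ℝ) * |(a : ℝ) / M₀ - (-(centre (M₀ * P) a) : ℤ) * P| = (circAbs (M₀ * P) a : ℝ) := by
      rw [← abs_add_mul_centre hN a, Int.cast_abs, ← abs_of_pos hM0, ← abs_mul, abs_of_pos hM0]
      congr 1
      push_cast
      rw [mul_sub, mul_div_cancel₀ _ hM0.ne']
      ring
    calc (M₀ : ℝ) * |crep (P : ℝ) ((a : ℝ) / M₀)|
        ≤ (M₀ : ℝ) * |(a : ℝ) / M₀ - (-(centre (M₀ * P) a) : ℤ) * P| := mul_le_mul_of_nonneg_left h1 hM0.le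
      _ = _ := h2
  · -- `circAbs ≤ |a − round·N| = M₀|crep|`
    have h3 : circAbs (M₀ * P) a ≤ |a - round ((a : ℝ) / M₀ / P) * ((M₀ * P : ℕ) : ℤ)| := by
      have := circAbs_le_abs hN (a - round ((a : ℝ) / M₀ / P) * ((M₀ * P : ℕ) : ℤ))
      have e : a - round ((a : ℝ) / M₀ / P) * ((M₀ * P : ℕ) : ℤ)
          = a + ((M₀ * P : ℕ) : ℤ) * (-round ((a : ℝ) / M₀ / P)) := by ring
      rw [e, circAbs_add_mul] at this
      rw [e]
      exact this
    have h4 : ((circAbs (M₀ * P) a : ℤ) : ℝ) ≤ |(a : ℝ) - (round ((a : ℝ) / M₀ / P) : ℝ) * ((M₀ * P : ℕ) : ℝ)| := by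
      have := h3
      have h' : (|a - round ((a : ℝ) / M₀ / P) * ((M₀ * P : ℕ) : ℤ)| : ℝ)
          = |(a : ℝ) - (round ((a : ℝ) / M₀ / P) : ℝ) * ((M₀ * P : ℕ) : ℝ)| := by push_cast; rfl
      rw [← h']
      exact_mod_cast this
    rw [← e1, abs_mul, abs_of_pos hM0] at h4
    exact h4

end Circle

/-! ## §2  The torus in real lifted coordinates: `h_z(y) = Π_i hper P_i (y_i/M₀ − z_i)` -/

section Lifted

variable {d : ℕ}

/-- **`h_z` on lifted real coordinates**: `hzR P M₀ z y = Π_i hper (P i) (y_i/M₀ − z_i)` for a centre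
`z ∈ Π_i ℤ/P_iℤ` (the index of the printed centre `M₀z ∈ T^{(k+m₀)}_{M₀}`) and `y ∈ ℝ^d`.
[cite: Balaban1984PropagatorsI, (1.118) p.36] -/
def hzR (P : Fin d → ℕ) (M₀ : ℝ) (z : TSite d P) (y : Fin d → ℝ) : ℝ :=
  ∏ i, hper (P i) (y i / M₀ - (z i).val)

/-- `0 ≤ h_z`. [cite: Balaban1984PropagatorsI, (1.118) p.36] -/
theorem hzR_nonneg (P : Fin d → ℕ) (M₀ : ℝ) (z : TSite d P) (y : Fin d → ℝ) : 0 ≤ hzR P M₀ z y :=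
  Finset.prod_nonneg fun _ _ => hper_nonneg _ _

/-- `h_z ≤ 1`. [cite: Balaban1984PropagatorsI, (1.118) p.36] -/
theorem hzR_le_one (P : Fin d → ℕ) (M₀ : ℝ) (z : TSite d P) (y : Fin d → ℝ) : hzR P M₀ z y ≤ 1 :=
  Finset.prod_le_one (fun _ _ => hper_nonneg _ _) fun _ _ => hper_le_one _ _

/-- **(1.118) on lifted coordinates: `Σ_z h_z(y)² = 1`** for every `y ∈ ℝ^d`, every cube scale `M₀` and every centre
torus with `P_i ≥ 2` cubes per direction. [cite: Balaban1984PropagatorsI, (1.118) p.36] -/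
theorem sum_hzR_sq {P : Fin d → ℕ} (hP : ∀ i, 2 ≤ P i) (M₀ : ℝ) (y : Fin d → ℝ) :
    ∑ z : TSite d P, hzR P M₀ z y ^ 2 = 1 := by
  unfold hzR
  simp_rw [← Finset.prod_pow]
  rw [← Fintype.prod_sum (fun i (c : Fin (P i)) => hper (P i) (y i / M₀ - c.val) ^ 2)]
  exact Finset.prod_eq_one fun i _ => sum_hper_sq (hP i) (y i / M₀)

/-- **periodicity**: shifting a lifted coordinate by a multiple of the period `N_i = M₀·P_i` does not change `h_z`.
[cite: Balaban1984PropagatorsI, (1.118) p.36] -/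
theorem hzR_add_period {P : Fin d → ℕ} (hP : ∀ i, 1 ≤ P i) {M₀ : ℝ} (hM : M₀ ≠ 0) (z : TSite d P)
    (y : Fin d → ℝ) (k : Fin d → ℤ) :
    hzR P M₀ z (fun i => y i + k i * (M₀ * P i)) = hzR P M₀ z y := by
  unfold hzR
  refine Finset.prod_congr rfl fun i _ => ?_
  rw [show (y i + k i * (M₀ * P i)) / M₀ - ((z i).val : ℝ) = (y i / M₀ - (z i).val) + k i * (P i : ℝ) by
    field_simp; ring]
  exact hper_add_int_mul (hP i) _ _

/-- **LOCAL CHART**: near every point `y₀ ∈ ℝ^d`, on the window `|y_i − y₀_i| ≤ ⅜M₀`, the torus function `h_z`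
IS the `Z^d`-indexed printed function `h_j(y) = Π_μ h(y_μ/M₀ − j_μ)` of `B4PartitionUnity22.hCube` for one label
`j ∈ ℤ^d`. (plumbing of the printed torus partition) [cite: Balaban1984PropagatorsI, (1.118) p.36] -/
theorem hzR_local {P : Fin d → ℕ} (hP : ∀ i, 2 ≤ P i) {M₀ : ℝ} (hM : 0 < M₀) (z : TSite d P) (y₀ : Fin d → ℝ) :
    ∃ j : Fin d → ℤ, ∀ y : Fin d → ℝ, (∀ i, |y i - y₀ i| ≤ 3 / 8 * M₀) → hzR P M₀ z y = hCube M₀ j y := by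
  choose m hm using fun i => hper_local (hP i) (y₀ i / M₀ - (z i).val)
  refine ⟨fun i => (z i).val + m i * P i, fun y hy => ?_⟩
  unfold hzR hCube
  refine Finset.prod_congr rfl fun i _ => ?_
  have hwin : |(y i / M₀ - (z i).val) - (y₀ i / M₀ - (z i).val)| ≤ 3 / 8 := by
    rw [show (y i / M₀ - ((z i).val : ℝ)) - (y₀ i / M₀ - (z i).val) = (y i - y₀ i) / M₀ by ring, abs_div,
      abs_of_pos hM, div_le_iff₀ hM]
    exact hy i
  rw [hm i _ hwin]
  congr 1
  push_cast
  ring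

/-- a coordinate update moves only that coordinate, by `|η|`. [folklore] -/
private theorem abs_update_sub_le (y : Fin d → ℝ) (μ : Fin d) (η : ℝ) {r : ℝ} (hr : |η| ≤ r) (i : Fin d) :
    |Function.update y μ (y μ + η) i - y i| ≤ r := by
  by_cases hi : i = μ
  · subst hi
    rw [Function.update_self, add_sub_cancel_left]
    exact hr
  · rw [Function.update_of_ne hi, sub_self, abs_zero]
    exact (abs_nonneg η).trans hr

/-- **first differences of `h_z` are `O(M₀⁻¹)`** (the first-order part of K(h), (1.121) p. 37; print: «the small factor
O(M₀⁻¹)» (1.128) p. 38 — v1.2: our shorthand for it stood inside guillemets here, QUOTE-AUDIT-B5 §G G2): for `M₀ ≥ 3` and every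
step `|η| ≤ 1` along an axis `μ`, `|h_z(y + ηe_μ) − h_z(y)| ≤ sup|h′|·|η|/M₀`, uniformly in the torus, `z`, `y`.
[cite: Balaban1984PropagatorsI, (1.118) p.36 with (1.121) p.37, (1.128) p.38] -/
theorem abs_hzR_diff_le {P : Fin d → ℕ} (hP : ∀ i, 2 ≤ P i) {M₀ : ℝ} (hM : 3 ≤ M₀) (z : TSite d P)
    (y : Fin d → ℝ) (μ : Fin d) {η : ℝ} (hη : |η| ≤ 1) :
    |hzR P M₀ z (Function.update y μ (y μ + η)) - hzR P M₀ z y| ≤ D1 hprof * |η| / M₀ := by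
  have hM0 : 0 < M₀ := by linarith
  obtain ⟨j, hj⟩ := hzR_local hP hM0 z y
  have hr : |η| ≤ 3 / 8 * M₀ := hη.trans (by linarith)
  rw [hj _ (abs_update_sub_le y μ η hr), hj y (fun i => by rw [sub_self, abs_zero]; positivity)]
  exact abs_hCube_diff_le hM0 j y μ η

/-- **second differences of `h_z` are `O(M₀⁻²)`**, per axis: for `M₀ ≥ 3`, `|η| ≤ 1`,
`|h_z(y + ηe_μ) − 2h_z(y) + h_z(y − ηe_μ)| ≤ sup|h″|·η²/M₀²`. [cite: Balaban1984PropagatorsI, (1.118) p.36 with (1.121) p.37] -/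
theorem abs_hzR_second_diff_le {P : Fin d → ℕ} (hP : ∀ i, 2 ≤ P i) {M₀ : ℝ} (hM : 3 ≤ M₀) (z : TSite d P)
    (y : Fin d → ℝ) (μ : Fin d) {η : ℝ} (hη : |η| ≤ 1) :
    |hzR P M₀ z (Function.update y μ (y μ + η)) - 2 * hzR P M₀ z y
        + hzR P M₀ z (Function.update y μ (y μ - η))| ≤ D2 hprof * η ^ 2 / M₀ ^ 2 := by
  have hM0 : 0 < M₀ := by linarith
  obtain ⟨j, hj⟩ := hzR_local hP hM0 z y
  have hr : |η| ≤ 3 / 8 * M₀ := hη.trans (by linarith)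
  have hr' : |(-η)| ≤ 3 / 8 * M₀ := by rwa [abs_neg]
  rw [hj _ (abs_update_sub_le y μ η hr), hj y (fun i => by rw [sub_self, abs_zero]; positivity),
    show y μ - η = y μ + -η by ring, hj _ (abs_update_sub_le y μ (-η) hr'), ← sub_eq_add_neg]
  exact abs_hCube_second_diff_le M₀ j y μ η

/-- **`Δh_z = O(M₀⁻²)` (our shorthand)**, lattice-Laplacian form: for `M₀ ≥ 3` and `0 < |η| ≤ 1`,
`|Σ_μ η⁻²(h_z(y + ηe_μ) − 2h_z(y) + h_z(y − ηe_μ))| ≤ d·sup|h″|/M₀²`, uniformly in `η`.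
[cite: Balaban1984PropagatorsI, (1.118) p.36 with (1.121) p.37] -/
theorem abs_latticeLaplacian_hzR_le {P : Fin d → ℕ} (hP : ∀ i, 2 ≤ P i) {M₀ : ℝ} (hM : 3 ≤ M₀) (z : TSite d P)
    (y : Fin d → ℝ) {η : ℝ} (hη0 : η ≠ 0) (hη : |η| ≤ 1) :
    |∑ μ, (η ^ 2)⁻¹ * (hzR P M₀ z (Function.update y μ (y μ + η)) - 2 * hzR P M₀ z y
        + hzR P M₀ z (Function.update y μ (y μ - η)))| ≤ d * (D2 hprof / M₀ ^ 2) := by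
  have hM0 : 0 < M₀ := by linarith
  obtain ⟨j, hj⟩ := hzR_local hP hM0 z y
  have hr : |η| ≤ 3 / 8 * M₀ := hη.trans (by linarith)
  have hr' : |(-η)| ≤ 3 / 8 * M₀ := by rwa [abs_neg]
  have hy0 : hzR P M₀ z y = hCube M₀ j y := hj y (fun i => by rw [sub_self, abs_zero]; positivity)
  have hrew : ∀ μ, hzR P M₀ z (Function.update y μ (y μ + η)) - 2 * hzR P M₀ z y
      + hzR P M₀ z (Function.update y μ (y μ - η))
      = hCube M₀ j (Function.update y μ (y μ + η)) - 2 * hCube M₀ j y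
      + hCube M₀ j (Function.update y μ (y μ - η)) := by
    intro μ
    rw [hj _ (abs_update_sub_le y μ η hr), hy0, show y μ - η = y μ + -η by ring,
      hj _ (abs_update_sub_le y μ (-η) hr')]
  simp_rw [hrew]
  have h := abs_latticeLaplacian_hCube_le M₀ j y hη0
  rwa [Fintype.card_fin] at h

end Lifted

/-! ## §3  Torus sites: (1.118) on `T = Π_i ℤ/N_iℤ` over the centre set `B5TorusCover.Ctr N M₀` -/

section Torus

variable {d : ℕ} (N : Fin d → ℕ)

/-- **`h_z` of (1.118) on torus sites**, with the printed profile: `h_z(x) = Π_i hper (N_i/M₀) (x_i/M₀ − z_i)`,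
centres indexed by `B5TorusCover.Ctr N M₀` (for `M₀ ∣ N_i`: `z_i ∈ ℤ/(N_i/M₀)ℤ`, centre site `M₀z`).
[cite: Balaban1984PropagatorsI, (1.118) p.36] -/
def hz118 (M₀ : ℕ) (z : Ctr N M₀) (x : TSite d N) : ℝ :=
  hzR (fun i => nC (N i) M₀) M₀ z (fun i => ((x i).val : ℝ))

variable {N}

/-- `0 ≤ h_z(x)`. [cite: Balaban1984PropagatorsI, (1.118) p.36] -/
theorem hz118_nonneg (M₀ : ℕ) (z : Ctr N M₀) (x : TSite d N) : 0 ≤ hz118 N M₀ z x := hzR_nonneg _ _ _ _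

/-- `h_z(x) ≤ 1`. [cite: Balaban1984PropagatorsI, (1.118) p.36] -/
theorem hz118_le_one (M₀ : ℕ) (z : Ctr N M₀) (x : TSite d N) : hz118 N M₀ z x ≤ 1 := hzR_le_one _ _ _ _

/-- **(1.118) `Σ_z h_z(x)² = 1` on the torus, with the printed profile**, for every cube scale `M₀` and every torus
with at least two cubes per direction (`2 ≤ N_i/M₀`). [cite: Balaban1984PropagatorsI, (1.118) p.36] -/
theorem sum_hz118_sq {M₀ : ℕ} (h2 : ∀ i, 2 ≤ nC (N i) M₀) (x : TSite d N) :
    ∑ z : Ctr N M₀, hz118 N M₀ z x ^ 2 = 1 :=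
  sum_hzR_sq h2 _ _

/-- the printed sublattice situation `M₀ ∣ N_i`, `N_i ≥ 2M₀`: then `nC (N i) M₀ = N_i/M₀` and `N_i = M₀·(N_i/M₀)`.
[cite: Balaban1984PropagatorsI, p.36 (T^{(k+m₀)}_{M₀} ⊂ T_η)] -/
theorem period_eq {M₀ : ℕ} (hM : 1 ≤ M₀) (hdvd : ∀ i, M₀ ∣ N i) (h2 : ∀ i, 2 * M₀ ≤ N i) (i : Fin d) :
    N i = M₀ * nC (N i) M₀ ∧ 2 ≤ nC (N i) M₀ := by
  have hq : 2 ≤ N i / M₀ := (Nat.le_div_iff_mul_le (by omega)).mpr (h2 i)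
  have hnC : nC (N i) M₀ = N i / M₀ := B5TorusCover.nC_eq_div (by omega)
  rw [hnC]
  exact ⟨(Nat.mul_div_cancel' (hdvd i)).symm, hq⟩

/-- **lift invariance**: `h_z` evaluated at ANY integer lift `a` of the site `x` (`a_i ≡ x_i mod N_i`) equals
`h_z(x)` — `h_z` is a function on the torus, as printed (`N_i = M₀·P_i`). [cite: Balaban1984PropagatorsI, (1.118) p.36] -/
theorem hz118_eq_hzR_of_lift {M₀ : ℕ} (hM : 1 ≤ M₀) (hN : ∀ i, N i = M₀ * nC (N i) M₀) (z : Ctr N M₀)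
    (x : TSite d N) (a : Fin d → ℤ) (ha : ∀ i, (a i : ℤ) ≡ (x i).val [ZMOD (N i)]) :
    hzR (fun i => nC (N i) M₀) M₀ z (fun i => (a i : ℝ)) = hz118 N M₀ z x := by
  unfold hz118
  have hM0 : (M₀ : ℝ) ≠ 0 := by exact_mod_cast (show M₀ ≠ 0 by omega)
  -- `a i = val + k i · N i`
  have hk : ∀ i, ∃ k : ℤ, (a i : ℤ) = (x i).val + k * (N i : ℤ) := by
    intro i
    obtain ⟨k, hk⟩ := (Int.modEq_iff_dvd.mp (ha i).symm)
    exact ⟨k, by linarith⟩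
  choose k hk using hk
  have := hzR_add_period (fun i => one_le_nC (N i) M₀) hM0 z (fun i => ((x i).val : ℝ)) k
  rw [← this]
  congr 1
  funext i
  have hNi : ((N i : ℕ) : ℝ) = (M₀ : ℝ) * (nC (N i) M₀ : ℝ) := by exact_mod_cast hN i
  rw [hk i]
  push_cast
  rw [hNi]

/-- the coordinate size: `M₀·|crep (N_i/M₀) (x_i/M₀ − z_i)| = dist_i(x, M₀z)` (circular coordinate distance).
(plumbing of the printed torus partition) [cite: Balaban1984PropagatorsI, (1.118) p.36] -/
theorem coord_size_eq {M₀ : ℕ} (hM : 1 ≤ M₀) (hN : ∀ i, N i = M₀ * nC (N i) M₀) (z : Ctr N M₀)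
    (x : TSite d N) (i : Fin d) :
    (M₀ : ℝ) * |crep (nC (N i) M₀ : ℝ) (((x i).val : ℝ) / M₀ - ((z i).val : ℝ))|
      = (circAbs (N i) (((x i).val : ℤ) - ((M₀ * (z i).val : ℕ) : ℤ)) : ℝ) := by
  have hM0 : (M₀ : ℝ) ≠ 0 := by exact_mod_cast (show M₀ ≠ 0 by omega)
  have h := natMul_abs_crep_eq_circAbs hM (one_le_nC (N i) M₀) (((x i).val : ℤ) - ((M₀ * (z i).val : ℕ) : ℤ))
  rw [← hN i] at h
  have e : ((x i).val : ℝ) / M₀ - ((z i).val : ℝ)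
      = ((((x i).val : ℤ) - ((M₀ * (z i).val : ℕ) : ℤ) : ℤ) : ℝ) / M₀ := by
    push_cast
    rw [sub_div, mul_div_cancel_left₀ _ hM0]
  rw [e]
  exact h

/-- **PLATEAU** `h_z(x) = 1` on the inner third of the cube: if `dist_∞(x, M₀z) ≤ M₀/3` then `h_z(x) = 1`.
[cite: Balaban1984PropagatorsI, (1.118) p.36 (h(t) = 1 for t ∈ [−⅓, ⅓])] -/
theorem hz118_eq_one {M₀ : ℕ} (hM : 1 ≤ M₀) (hN1 : ∀ i, 1 ≤ N i) (hN : ∀ i, N i = M₀ * nC (N i) M₀)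
    {z : Ctr N M₀} {x : TSite d N} (h : 3 * tdist N x (ctr hN1 M₀ z) ≤ M₀) : hz118 N M₀ z x = 1 := by
  have hM0 : (0 : ℝ) < M₀ := by exact_mod_cast hM
  unfold hz118 hzR
  refine Finset.prod_eq_one fun i _ => hper_eq_one ?_
  have hc := circAbs_le_tdist hN1 x (ctr hN1 M₀ z) i
  rw [ctr_val hN1 M₀ z i] at hc
  rw [← coord_size_eq hM hN z x i] at hc
  nlinarith

/-- **SUPPORT** `supp h_z ⊂ □_z`: if `dist_∞(x, M₀z) ≥ ⅔M₀` then `h_z(x) = 0` (the cube `□_z` «of size 2M₀ and with a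
center at the point z» is `{dist_∞ ≤ M₀}`). [cite: Balaban1984PropagatorsI, (1.118) p.36 (h ∈ C₀^∞(]−⅔, ⅔[))] -/
theorem hz118_eq_zero_of_le {M₀ : ℕ} (hM : 1 ≤ M₀) (hN1 : ∀ i, 1 ≤ N i) (hN : ∀ i, N i = M₀ * nC (N i) M₀)
    {z : Ctr N M₀} {x : TSite d N} (h : 2 * (M₀ : ℝ) ≤ 3 * tdist N x (ctr hN1 M₀ z)) : hz118 N M₀ z x = 0 := by
  have hM0 : (0 : ℝ) < M₀ := by exact_mod_cast hM
  rcases (Finset.univ : Finset (Fin d)).eq_empty_or_nonempty with he | hne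
  · exfalso
    have h0 : tdist N x (ctr hN1 M₀ z) = 0 := by
      unfold tdist
      rw [he, Finset.sup_empty, bot_eq_zero, Nat.cast_zero]
    rw [h0] at h
    linarith
  · obtain ⟨i, -, hi⟩ := Finset.exists_mem_eq_sup Finset.univ hne (ccoord N x (ctr hN1 M₀ z))
    have h1 : tdist N x (ctr hN1 M₀ z) = (circAbs (N i) (((x i).val : ℤ) - ((M₀ * (z i).val : ℕ) : ℤ)) : ℝ) := by
      unfold tdist
      rw [hi]
      have := ccoord_cast hN1 x (ctr hN1 M₀ z) i
      rw [ctr_val hN1 M₀ z i] at this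
      exact_mod_cast this
    rw [h1, ← coord_size_eq hM hN z x i] at h
    unfold hz118 hzR
    apply Finset.prod_eq_zero (Finset.mem_univ i)
    apply hper_eq_zero
    nlinarith

/-- **first differences on the torus** (`M₀ ≥ 3`, `N_i = M₀P_i`, `P_i ≥ 2`): for neighbouring sites `x`, `x'`
(one coordinate changed by `±1 mod N_μ`), `|h_z(x') − h_z(x)| ≤ sup|h′|/M₀` — stated on integer lifts, which by
`hz118_eq_hzR_of_lift` is the torus statement. [cite: Balaban1984PropagatorsI, (1.118) p.36 with (1.128) p.38] -/
theorem abs_hz118_lift_diff_le {M₀ : ℕ} (hM : 3 ≤ M₀) (h2 : ∀ i, 2 ≤ nC (N i) M₀) (z : Ctr N M₀)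
    (a : Fin d → ℤ) (μ : Fin d) {η : ℤ} (hη : |η| ≤ 1) :
    |hzR (fun i => nC (N i) M₀) M₀ z (fun i => ((Function.update a μ (a μ + η) i : ℤ) : ℝ))
      - hzR (fun i => nC (N i) M₀) M₀ z (fun i => (a i : ℝ))| ≤ D1 hprof * |(η : ℝ)| / M₀ := by
  have hM' : (3 : ℝ) ≤ M₀ := by exact_mod_cast hM
  have hη' : |(η : ℝ)| ≤ 1 := by rw [← Int.cast_abs]; exact_mod_cast hη
  have hfun : (fun i => ((Function.update a μ (a μ + η) i : ℤ) : ℝ))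
      = Function.update (fun i => (a i : ℝ)) μ ((a μ : ℝ) + η) := by
    funext i
    by_cases hi : i = μ
    · subst hi; simp
    · simp [Function.update_of_ne hi]
  rw [hfun]
  exact abs_hzR_diff_le h2 hM' z _ μ hη'

/-- **second differences on the torus** (`M₀ ≥ 3`): `|h_z(a + e_μ) − 2h_z(a) + h_z(a − e_μ)| ≤ sup|h″|/M₀²` on
integer lifts. [cite: Balaban1984PropagatorsI, (1.118) p.36 with (1.121) p.37] -/
theorem abs_hz118_lift_second_diff_le {M₀ : ℕ} (hM : 3 ≤ M₀) (h2 : ∀ i, 2 ≤ nC (N i) M₀) (z : Ctr N M₀)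
    (a : Fin d → ℤ) (μ : Fin d) :
    |hzR (fun i => nC (N i) M₀) M₀ z (fun i => ((Function.update a μ (a μ + 1) i : ℤ) : ℝ))
      - 2 * hzR (fun i => nC (N i) M₀) M₀ z (fun i => (a i : ℝ))
      + hzR (fun i => nC (N i) M₀) M₀ z (fun i => ((Function.update a μ (a μ - 1) i : ℤ) : ℝ))|
      ≤ D2 hprof / (M₀ : ℝ) ^ 2 := by
  have hM' : (3 : ℝ) ≤ M₀ := by exact_mod_cast hM
  have hfun1 : (fun i => ((Function.update a μ (a μ + 1) i : ℤ) : ℝ))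
      = Function.update (fun i => (a i : ℝ)) μ ((a μ : ℝ) + 1) := by
    funext i
    by_cases hi : i = μ
    · subst hi; simp
    · simp [Function.update_of_ne hi]
  have hfun2 : (fun i => ((Function.update a μ (a μ - 1) i : ℤ) : ℝ))
      = Function.update (fun i => (a i : ℝ)) μ ((a μ : ℝ) - 1) := by
    funext i
    by_cases hi : i = μ
    · subst hi; simp
    · simp [Function.update_of_ne hi]
  rw [hfun1, hfun2]
  have h := abs_hzR_second_diff_le h2 hM' z (fun i => (a i : ℝ)) μ (η := 1) (by norm_num)
  simpa using h

end Torus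

/-! ## §4  Multiplication operators: the fields `h118`, `symmH`, support half of `hJloc` of `B5Local114.Realisation` -/

section Operators

variable {d : ℕ} (N : Fin d → ℕ) {ι : Type*}

/-- `h_z` on the metric carrier `UT N` of `B5TorusCover`. [cite: Balaban1984PropagatorsI, (1.118) p.36] -/
def hz118U (M₀ : ℕ) (z : Ctr N M₀) (x : UT N) : ℝ := hz118 N M₀ z (UT.toSite N x)

/-- **The operators `h_z` of (1.119)–(1.123)** (multiplication by `h_z ∘ π` on `ℓ²(ι)`, `ι` fibred over the torus by
`π`), with the PRINTED profile: the `H : S → Module.End ℝ V` of `B5Local114.Realisation` (`S := Ctr N M₀`,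
`V := EuclideanSpace ℝ ι`). [cite: Balaban1984PropagatorsI, (1.118)–(1.119) p.36] -/
def Hop118 (M₀ : ℕ) (π : ι → UT N) (z : Ctr N M₀) : Module.End ℝ (EuclideanSpace ℝ ι) :=
  mulOp fun i => hz118U N M₀ z (π i)

/-- **field `symmH`**: each `Hop118 z` is symmetric. [cite: Balaban1984PropagatorsI, (1.119) p.36] -/
theorem symmH_printed [Fintype ι] (M₀ : ℕ) (π : ι → UT N) :
    ∀ (z : Ctr N M₀) (u v : EuclideanSpace ℝ ι),
      inner ℝ (Hop118 N M₀ π z u) v = inner ℝ u (Hop118 N M₀ π z v) :=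
  fun _ u v => inner_mulOp_left _ u v

/-- **field `h118`: `Σ_z H_z H_z = 1`** for `H := Hop118 N M₀ π` — the operator form of (1.118) with the printed
profile, every torus with `≥ 2` cubes per direction, every fibring `π`. [cite: Balaban1984PropagatorsI, (1.118) p.36] -/
theorem h118_printed {M₀ : ℕ} (h2 : ∀ i, 2 ≤ nC (N i) M₀) (π : ι → UT N) :
    ∑ z : Ctr N M₀, Hop118 N M₀ π z * Hop118 N M₀ π z = 1 :=
  sum_mulOp_mul_self _ fun i => sum_hz118_sq h2 (UT.toSite N (π i))

/-- `‖H_z v‖ ≤ ‖v‖`. [cite: Balaban1984PropagatorsI, (1.119) p.36] -/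
theorem norm_Hop118_le [Fintype ι] (M₀ : ℕ) (π : ι → UT N) (z : Ctr N M₀) (v : EuclideanSpace ℝ ι) :
    ‖Hop118 N M₀ π z v‖ ≤ ‖v‖ := by
  have ha : ∀ i, |hz118U N M₀ z (π i)| ≤ 1 := fun i => by
    unfold hz118U
    rw [abs_of_nonneg (hz118_nonneg M₀ z _)]
    exact hz118_le_one M₀ z _
  have h := norm_mulOp_le (a := fun i => hz118U N M₀ z (π i)) zero_le_one ha v
  rw [one_mul] at h
  exact h

variable [∀ i, NeZero (N i)]

/-- **support of `H_z`** (`N_i = M₀P_i`): if `v` vanishes at every component whose base point is within sup-distance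
`< ⅔M₀` of the centre `M₀z`, then `H_z v = 0`. [cite: Balaban1984PropagatorsI, (1.118) p.36 (supp h_z ⊂ □_z)] -/
theorem Hop118_eq_zero_of_far {M₀ : ℕ} (hM : 1 ≤ M₀) (hN : ∀ i, N i = M₀ * nC (N i) M₀) (π : ι → UT N)
    (z : Ctr N M₀) (v : EuclideanSpace ℝ ι)
    (h : ∀ i, 3 * dist (π i) (ctrU N M₀ z) < 2 * M₀ → v i = 0) : Hop118 N M₀ π z v = 0 := by
  apply mulOp_eq_zero_of_vanish
  intro i hi
  apply h i
  by_contra hfar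
  apply hi
  unfold hz118U
  exact hz118_eq_zero_of_le hM (UT.one_le N) hN (not_lt.mp hfar)

/-- **the support half of the field `hJloc`, by shape**: if `v` vanishes at every component farther than `r` from
`y`, and the centre `z` is not within `c ≥ ⅔M₀ + r` of `y`, then `H_z v = 0`. [cite: Balaban1984PropagatorsI,
(1.131) p.38 (summation range ω: y ∈ □_{ω₀}, y′ ∈ □_{ω_n}) — located by shape, the reader's gloss] -/
theorem Hop118_eq_zero_of_supp {M₀ : ℕ} (hM : 1 ≤ M₀) (hN : ∀ i, N i = M₀ * nC (N i) M₀) (π : ι → UT N)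
    {c r : ℝ} (hc : 2 / 3 * M₀ + r ≤ c) (y : UT N) (v : EuclideanSpace ℝ ι)
    (hv : ∀ i, r < dist (π i) y → v i = 0) (z : Ctr N M₀) (hzy : ¬ dist (ctrU N M₀ z) y ≤ c) :
    Hop118 N M₀ π z v = 0 := by
  apply Hop118_eq_zero_of_far N hM hN π z v
  intro i hi
  apply hv i
  by_contra hri
  rw [not_lt] at hri
  apply hzy
  calc dist (ctrU N M₀ z) y ≤ dist (ctrU N M₀ z) (π i) + dist (π i) y := dist_triangle _ _ _
    _ ≤ 2 / 3 * M₀ + r := by rw [dist_comm]; linarith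
    _ ≤ c := hc

omit [∀ i, NeZero (N i)] in
/-- `Σ_z h_z(x)² = 1` on the carrier (= (1.118)). [cite: Balaban1984PropagatorsI, (1.118) p.36] -/
theorem sum_hz118U_sq {M₀ : ℕ} (h2 : ∀ i, 2 ≤ nC (N i) M₀) (x : UT N) :
    ∑ z : Ctr N M₀, hz118U N M₀ z x ^ 2 = 1 :=
  sum_hz118_sq h2 _

end Operators

/-! ## §5  Smoothness as printed: `hper P ∈ C^∞(ℝ)`, `h_z ∈ C^∞(ℝ^d)` (v1.1) -/

section Smooth

/-- **the periodised printed profile is `C^∞`** (`P ≥ 2`): near every point it is an integer translate of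
`h ∈ C^∞` (`hper_local`). [cite: Balaban1984PropagatorsI, (1.118) p.36 (h ∈ C₀^∞)] -/
theorem contDiff_hper {P : ℕ} (hP : 2 ≤ P) {n : ℕ∞} : ContDiff ℝ n (hper P) := by
  rw [contDiff_iff_contDiffAt]
  intro u
  obtain ⟨m, hm⟩ := hper_local hP u
  have hf : ContDiff ℝ n (fun v : ℝ => hprof (v - m * P)) :=
    contDiff_hprof.comp (contDiff_id.sub contDiff_const)
  refine hf.contDiffAt.congr_of_eventuallyEq ?_
  filter_upwards [Metric.ball_mem_nhds u (by norm_num : (0 : ℝ) < 3 / 8)] with v hv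
  exact hm v (le_of_lt (by rwa [Metric.mem_ball, Real.dist_eq] at hv))

variable {d : ℕ}

/-- **`h_z(y) = Π_μ h((y_μ − z_μ)/M₀)` is a `C^∞` function of `y ∈ ℝ^d`** (every `M₀`, `P_i ≥ 2`) — the torus partition
functions `hz118` are its values at the lattice points. [cite: Balaban1984PropagatorsI, (1.118) p.36 (h ∈ C₀^∞)] -/
theorem contDiff_hzR {P : Fin d → ℕ} (hP : ∀ i, 2 ≤ P i) (M₀ : ℝ) (z : TSite d P) {n : ℕ∞} :
    ContDiff ℝ n (hzR P M₀ z) := by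
  unfold hzR
  refine contDiff_prod fun i _ => ?_
  exact (contDiff_hper (hP i)).comp (((contDiff_apply ℝ ℝ i).div_const M₀).sub contDiff_const)

end Smooth

end

end Literature.MathematicalPhysics.QuantumFieldTheory.Balaban1983to89.B5Partition118Printed
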